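import Summits.NavierStokesRegularity.NavierStokesRegularity.Theses.TypeILiouville
import Summits.NavierStokesRegularity.NavierStokesRegularity.Theses.ThreadingFlux
import HarnessLib

/-!
# Hard core `NoTypeII` (stmt-NavierStokesRegularity-0056 = `TypeILiouville.TypeIliouvilleNoTypeII`):
# the TYPE-II-SIDE DOOR CALCULUS — closes-glue, tautology certificate and location for every
# «a-priori estimate excluding Type-II blow-up» candidate (D-0081 §B)

`NoTypeII` says: a maximal classical solution of unforced Navier–Stokes on `ℝ³ × [0,T)` (no classical
continuation past `T`) which is Leray–Hopf from a rapidly decaying datum blows up at most at the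
self-similar rate, `IsTypeIBlowup u T` (`‖u(t)‖_∞ ≤ C (T−t)^{-1/2}` eventually). A Type-II-exclusion
CANDIDATE is a per-solution clause `D ν T u p` (an a-priori estimate, possibly only meaningful on a named
class) asserted for every solution of the frame. This file is the Type-II-side twin of the Type-I-side door
calculus `door_iff_target_of_kill_of_regular` (Theorems/ScaledTopAlignmentMostTimesHardCoreMeet.lean): pure
logic over the route declarations, no new definitions, so that planners, critics and provers of the §B cell
can state the three obligations of a candidate BY NAME and read off its logical position at once.

For a clause `D` the three side conditions are
* KILL      `hkill : maximal ∧ Leray–Hopf ∧ decay ∧ D ⇒ IsTypeIBlowup u T` (the kit side: the estimate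
  controls the rate);
* NECESSARY `hnec  : maximal ∧ Leray–Hopf ∧ decay ∧ IsTypeIBlowup u T ⇒ D` (the Type-I rate already gives
  the estimate on blow-ups);
* REGULAR   `hreg  : classical ∧ Leray–Hopf ∧ decay ∧ HasSmoothExtensionPast ⇒ D` (the estimate is empty
  on solutions that continue past `T`).

Results (all `[folklore]`, elementary):
* `typeIliouvilleNoTypeII_of_blowupClause_of_kill`, `typeIliouvilleNoTypeII_of_aprioriClause_of_kill` —
  CLOSES-GLUE: KILL ⊢ (∀ blow-ups, D) → NoTypeII and (∀ frame, D) → NoTypeII;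
* `blowupClause_iff_typeIliouvilleNoTypeII`, `aprioriClause_iff_typeIliouvilleNoTypeII` — TAUTOLOGY
  CERTIFICATE: KILL ∧ NECESSARY ⊢ (∀ blow-ups, D) ↔ NoTypeII, and with REGULAR also (∀ frame, D) ↔ NoTypeII.
  A candidate for which all three are provable is a RESTATEMENT of the hard core (memo D-0081 §B: KILL =
  TAUTOLOGY-SUSPECT), by name;
* `blowupClause_iff_typeIliouvilleNoTypeII_and_typeIResidue` — LOCATION: KILL ⊢ (∀ blow-ups, D) ↔
  NoTypeII ∧ (∀ Type-I blow-ups, D): the content of a candidate beyond the hard core sits exactly on TYPE-I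
  blow-ups, i.e. inside the realm of the other hard core `ThreadingFlux.Target` (stmt-1217), which empties
  it (`typeIResidue_of_target`, `blowupClause_iff_typeIliouvilleNoTypeII_of_target`);
* class-restricted forms («no Type-II blow-up IN a class 𝒞»): `noTypeIIIn_of_typeIliouvilleNoTypeII`,
  `noTypeIIIn_mono`, `typeIliouvilleNoTypeII_of_noTypeIIIn_of_compl` (split over 𝒞 / ¬𝒞),
  `noBlowupIn_of_noTypeIIIn_of_targetIn` (with Type-I exclusion in 𝒞: no blow-up in 𝒞);
* `navierStokesRegularity_of_blowupClause_of_kill_of_target` — the full deciding-theorem shape of a §B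
  route: (∀ blow-ups, D) → KILL → Target (residual) → Clay (A), through `TypeILiouville.Assembly_holds`;
* `typeIliouvilleNoTypeII_iff_threadingFluxNoTypeII` — the two route copies of the hard core agree (`Iff.rfl`).

WHAT THIS IS NOT: not NS regularity; nothing here proves or refutes `NoTypeII`, `Target` or any candidate —
implications between OPEN statements, recorded so that the §B keep/kill test has kernel targets. [folklore]
-/

noncomputable section
-- the summit and its single sub-problem share the name (CONVENTIONS §1), as in every Theorems file
set_option linter.dupNamespace false

namespace Summit.NavierStokesRegularity.NavierStokesRegularity.Theorems

open Literature.Analysis.FluidPDE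
open Summit.NavierStokesRegularity.NavierStokesRegularity.Theses.TypeILiouville (TypeIliouvilleNoTypeII)
open Summit.NavierStokesRegularity.NavierStokesRegularity.Theses.ThreadingFlux (Target)

variable {D 𝒞 𝒞' : ℝ → ℝ → (ℝ → EuclideanSpace ℝ (Fin 3) → EuclideanSpace ℝ (Fin 3)) →
  (ℝ → EuclideanSpace ℝ (Fin 3) → ℝ) → Prop}

/-! ### Closes-glue: an estimate that controls the rate excludes Type-II blow-up -/

/-- **CLOSES-GLUE (blow-up form).** If the clause `D` holds for every maximal classical Leray–Hopf solution
from a rapidly decaying datum, and `D` forces the Type-I rate on such solutions (KILL), then `NoTypeII`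
(stmt-NavierStokesRegularity-0056) holds. This is the deciding-theorem shape of a Type-II-exclusion route
with crux `∀ blow-ups, D`. [folklore] -/
theorem typeIliouvilleNoTypeII_of_blowupClause_of_kill
    (hD : ∀ (ν T : ℝ), 0 < ν → 0 < T →
      ∀ (u : ℝ → EuclideanSpace ℝ (Fin 3) → EuclideanSpace ℝ (Fin 3))
      (p : ℝ → EuclideanSpace ℝ (Fin 3) → ℝ),
      IsMaximalSmoothSolution ν 0 u p T → IsLerayHopfOn T ν 0 (u 0) u → HasRapidSpatialDecay (u 0) →
      D ν T u p)
    (hkill : ∀ (ν T : ℝ), 0 < ν → 0 < T →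
      ∀ (u : ℝ → EuclideanSpace ℝ (Fin 3) → EuclideanSpace ℝ (Fin 3))
      (p : ℝ → EuclideanSpace ℝ (Fin 3) → ℝ),
      IsMaximalSmoothSolution ν 0 u p T → IsLerayHopfOn T ν 0 (u 0) u → HasRapidSpatialDecay (u 0) →
      D ν T u p → IsTypeIBlowup u T) :
    TypeIliouvilleNoTypeII :=
  fun ν T hν hT u p hmax hLH hdec =>
    hkill ν T hν hT u p hmax hLH hdec (hD ν T hν hT u p hmax hLH hdec)

/-- **CLOSES-GLUE (a-priori form).** If the clause `D` holds for every classical Leray–Hopf solution on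
`[0,T)` from a rapidly decaying datum (whether or not it continues past `T`), and KILL holds, then
`NoTypeII`. [folklore] -/
theorem typeIliouvilleNoTypeII_of_aprioriClause_of_kill
    (hD : ∀ (ν T : ℝ), 0 < ν → 0 < T →
      ∀ (u : ℝ → EuclideanSpace ℝ (Fin 3) → EuclideanSpace ℝ (Fin 3))
      (p : ℝ → EuclideanSpace ℝ (Fin 3) → ℝ),
      IsClassicalNSSolutionOn (Set.Ico 0 T) ν 0 u p → IsLerayHopfOn T ν 0 (u 0) u →
      HasRapidSpatialDecay (u 0) → D ν T u p)
    (hkill : ∀ (ν T : ℝ), 0 < ν → 0 < T →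
      ∀ (u : ℝ → EuclideanSpace ℝ (Fin 3) → EuclideanSpace ℝ (Fin 3))
      (p : ℝ → EuclideanSpace ℝ (Fin 3) → ℝ),
      IsMaximalSmoothSolution ν 0 u p T → IsLerayHopfOn T ν 0 (u 0) u → HasRapidSpatialDecay (u 0) →
      D ν T u p → IsTypeIBlowup u T) :
    TypeIliouvilleNoTypeII :=
  typeIliouvilleNoTypeII_of_blowupClause_of_kill
    (fun ν T hν hT u p hmax hLH hdec => hD ν T hν hT u p hmax.1 hLH hdec) hkill

/-! ### Converse direction: when the hard core already gives the candidate -/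

/-- **NECESSARY ⊢ NoTypeII ⇒ (∀ blow-ups, D).** If the Type-I rate of a maximal solution already yields the
clause (NECESSARY), then `NoTypeII` gives the clause on every blow-up. [folklore] -/
theorem blowupClause_of_typeIliouvilleNoTypeII_of_necessary (hII : TypeIliouvilleNoTypeII)
    (hnec : ∀ (ν T : ℝ), 0 < ν → 0 < T →
      ∀ (u : ℝ → EuclideanSpace ℝ (Fin 3) → EuclideanSpace ℝ (Fin 3))
      (p : ℝ → EuclideanSpace ℝ (Fin 3) → ℝ),
      IsMaximalSmoothSolution ν 0 u p T → IsLerayHopfOn T ν 0 (u 0) u → HasRapidSpatialDecay (u 0) →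
      IsTypeIBlowup u T → D ν T u p) :
    ∀ (ν T : ℝ), 0 < ν → 0 < T →
      ∀ (u : ℝ → EuclideanSpace ℝ (Fin 3) → EuclideanSpace ℝ (Fin 3))
      (p : ℝ → EuclideanSpace ℝ (Fin 3) → ℝ),
      IsMaximalSmoothSolution ν 0 u p T → IsLerayHopfOn T ν 0 (u 0) u → HasRapidSpatialDecay (u 0) →
      D ν T u p :=
  fun ν T hν hT u p hmax hLH hdec =>
    hnec ν T hν hT u p hmax hLH hdec (hII ν T hν hT u p hmax hLH hdec)

/-- **NECESSARY ∧ REGULAR ⊢ NoTypeII ⇒ (∀ frame, D).** With the regular case (the clause is automatic on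
solutions continuing past `T`), `NoTypeII` gives the clause a priori on the whole frame. [folklore] -/
theorem aprioriClause_of_typeIliouvilleNoTypeII_of_necessary_of_regular (hII : TypeIliouvilleNoTypeII)
    (hnec : ∀ (ν T : ℝ), 0 < ν → 0 < T →
      ∀ (u : ℝ → EuclideanSpace ℝ (Fin 3) → EuclideanSpace ℝ (Fin 3))
      (p : ℝ → EuclideanSpace ℝ (Fin 3) → ℝ),
      IsMaximalSmoothSolution ν 0 u p T → IsLerayHopfOn T ν 0 (u 0) u → HasRapidSpatialDecay (u 0) →
      IsTypeIBlowup u T → D ν T u p)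
    (hreg : ∀ (ν T : ℝ), 0 < ν → 0 < T →
      ∀ (u : ℝ → EuclideanSpace ℝ (Fin 3) → EuclideanSpace ℝ (Fin 3))
      (p : ℝ → EuclideanSpace ℝ (Fin 3) → ℝ),
      IsClassicalNSSolutionOn (Set.Ico 0 T) ν 0 u p → IsLerayHopfOn T ν 0 (u 0) u →
      HasRapidSpatialDecay (u 0) → HasSmoothExtensionPast ν 0 u T → D ν T u p) :
    ∀ (ν T : ℝ), 0 < ν → 0 < T →
      ∀ (u : ℝ → EuclideanSpace ℝ (Fin 3) → EuclideanSpace ℝ (Fin 3))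
      (p : ℝ → EuclideanSpace ℝ (Fin 3) → ℝ),
      IsClassicalNSSolutionOn (Set.Ico 0 T) ν 0 u p → IsLerayHopfOn T ν 0 (u 0) u →
      HasRapidSpatialDecay (u 0) → D ν T u p := by
  intro ν T hν hT u p hcl hLH hdec
  by_cases hext : HasSmoothExtensionPast ν 0 u T
  · exact hreg ν T hν hT u p hcl hLH hdec hext
  · exact hnec ν T hν hT u p ⟨hcl, hext⟩ hLH hdec (hII ν T hν hT u p ⟨hcl, hext⟩ hLH hdec)

/-! ### Tautology certificate (memo D-0081 §B: KILL = TAUTOLOGY-SUSPECT, made a kernel test) -/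

/-- **TAUTOLOGY CERTIFICATE (blow-up form).** If KILL and NECESSARY are both provable for the clause `D`,
then the candidate `∀ blow-ups, D` is EQUIVALENT to the hard core `NoTypeII` — a restatement, not a new
crux. [folklore] -/
theorem blowupClause_iff_typeIliouvilleNoTypeII
    (hkill : ∀ (ν T : ℝ), 0 < ν → 0 < T →
      ∀ (u : ℝ → EuclideanSpace ℝ (Fin 3) → EuclideanSpace ℝ (Fin 3))
      (p : ℝ → EuclideanSpace ℝ (Fin 3) → ℝ),
      IsMaximalSmoothSolution ν 0 u p T → IsLerayHopfOn T ν 0 (u 0) u → HasRapidSpatialDecay (u 0) →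
      D ν T u p → IsTypeIBlowup u T)
    (hnec : ∀ (ν T : ℝ), 0 < ν → 0 < T →
      ∀ (u : ℝ → EuclideanSpace ℝ (Fin 3) → EuclideanSpace ℝ (Fin 3))
      (p : ℝ → EuclideanSpace ℝ (Fin 3) → ℝ),
      IsMaximalSmoothSolution ν 0 u p T → IsLerayHopfOn T ν 0 (u 0) u → HasRapidSpatialDecay (u 0) →
      IsTypeIBlowup u T → D ν T u p) :
    (∀ (ν T : ℝ), 0 < ν → 0 < T →
      ∀ (u : ℝ → EuclideanSpace ℝ (Fin 3) → EuclideanSpace ℝ (Fin 3))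
      (p : ℝ → EuclideanSpace ℝ (Fin 3) → ℝ),
      IsMaximalSmoothSolution ν 0 u p T → IsLerayHopfOn T ν 0 (u 0) u → HasRapidSpatialDecay (u 0) →
      D ν T u p) ↔ TypeIliouvilleNoTypeII :=
  ⟨fun hD => typeIliouvilleNoTypeII_of_blowupClause_of_kill hD hkill,
    fun hII => blowupClause_of_typeIliouvilleNoTypeII_of_necessary hII hnec⟩

/-- **TAUTOLOGY CERTIFICATE (a-priori form).** If KILL, NECESSARY and REGULAR are all provable for `D`,
then the a-priori candidate `∀ frame, D` is EQUIVALENT to `NoTypeII`. [folklore] -/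
theorem aprioriClause_iff_typeIliouvilleNoTypeII
    (hkill : ∀ (ν T : ℝ), 0 < ν → 0 < T →
      ∀ (u : ℝ → EuclideanSpace ℝ (Fin 3) → EuclideanSpace ℝ (Fin 3))
      (p : ℝ → EuclideanSpace ℝ (Fin 3) → ℝ),
      IsMaximalSmoothSolution ν 0 u p T → IsLerayHopfOn T ν 0 (u 0) u → HasRapidSpatialDecay (u 0) →
      D ν T u p → IsTypeIBlowup u T)
    (hnec : ∀ (ν T : ℝ), 0 < ν → 0 < T →
      ∀ (u : ℝ → EuclideanSpace ℝ (Fin 3) → EuclideanSpace ℝ (Fin 3))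
      (p : ℝ → EuclideanSpace ℝ (Fin 3) → ℝ),
      IsMaximalSmoothSolution ν 0 u p T → IsLerayHopfOn T ν 0 (u 0) u → HasRapidSpatialDecay (u 0) →
      IsTypeIBlowup u T → D ν T u p)
    (hreg : ∀ (ν T : ℝ), 0 < ν → 0 < T →
      ∀ (u : ℝ → EuclideanSpace ℝ (Fin 3) → EuclideanSpace ℝ (Fin 3))
      (p : ℝ → EuclideanSpace ℝ (Fin 3) → ℝ),
      IsClassicalNSSolutionOn (Set.Ico 0 T) ν 0 u p → IsLerayHopfOn T ν 0 (u 0) u →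
      HasRapidSpatialDecay (u 0) → HasSmoothExtensionPast ν 0 u T → D ν T u p) :
    (∀ (ν T : ℝ), 0 < ν → 0 < T →
      ∀ (u : ℝ → EuclideanSpace ℝ (Fin 3) → EuclideanSpace ℝ (Fin 3))
      (p : ℝ → EuclideanSpace ℝ (Fin 3) → ℝ),
      IsClassicalNSSolutionOn (Set.Ico 0 T) ν 0 u p → IsLerayHopfOn T ν 0 (u 0) u →
      HasRapidSpatialDecay (u 0) → D ν T u p) ↔ TypeIliouvilleNoTypeII :=
  ⟨fun hD => typeIliouvilleNoTypeII_of_aprioriClause_of_kill hD hkill,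
    fun hII => aprioriClause_of_typeIliouvilleNoTypeII_of_necessary_of_regular hII hnec hreg⟩

/-! ### Location: the content of a candidate beyond the hard core is its Type-I residue -/

/-- **LOCATION.** Under KILL alone (no necessity assumed), the candidate `∀ blow-ups, D` is equivalent to
`NoTypeII` TOGETHER WITH its TYPE-I RESIDUE `∀ Type-I blow-ups, D`: what a Type-II-exclusion estimate says
beyond the hard core 0056 is said about Type-I blow-ups only — the realm of the other hard core
`ThreadingFlux.Target` (stmt-NavierStokesRegularity-1217). [folklore] -/
theorem blowupClause_iff_typeIliouvilleNoTypeII_and_typeIResidue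
    (hkill : ∀ (ν T : ℝ), 0 < ν → 0 < T →
      ∀ (u : ℝ → EuclideanSpace ℝ (Fin 3) → EuclideanSpace ℝ (Fin 3))
      (p : ℝ → EuclideanSpace ℝ (Fin 3) → ℝ),
      IsMaximalSmoothSolution ν 0 u p T → IsLerayHopfOn T ν 0 (u 0) u → HasRapidSpatialDecay (u 0) →
      D ν T u p → IsTypeIBlowup u T) :
    (∀ (ν T : ℝ), 0 < ν → 0 < T →
      ∀ (u : ℝ → EuclideanSpace ℝ (Fin 3) → EuclideanSpace ℝ (Fin 3))
      (p : ℝ → EuclideanSpace ℝ (Fin 3) → ℝ),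
      IsMaximalSmoothSolution ν 0 u p T → IsLerayHopfOn T ν 0 (u 0) u → HasRapidSpatialDecay (u 0) →
      D ν T u p) ↔
    TypeIliouvilleNoTypeII ∧
      (∀ (ν T : ℝ), 0 < ν → 0 < T →
        ∀ (u : ℝ → EuclideanSpace ℝ (Fin 3) → EuclideanSpace ℝ (Fin 3))
        (p : ℝ → EuclideanSpace ℝ (Fin 3) → ℝ),
        IsMaximalSmoothSolution ν 0 u p T → IsLerayHopfOn T ν 0 (u 0) u → HasRapidSpatialDecay (u 0) →
        IsTypeIBlowup u T → D ν T u p) :=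
  ⟨fun hD => ⟨typeIliouvilleNoTypeII_of_blowupClause_of_kill hD hkill,
      fun ν T hν hT u p hmax hLH hdec _ => hD ν T hν hT u p hmax hLH hdec⟩,
    fun h => blowupClause_of_typeIliouvilleNoTypeII_of_necessary h.1 h.2⟩

/-- **Target empties the Type-I residue.** If `ThreadingFlux.Target` (no Type-I blow-up, stmt-1217) holds,
then a maximal solution with the Type-I rate does not exist, so the Type-I residue of ANY clause `D` holds
vacuously. [folklore] -/
theorem typeIResidue_of_target (hT : Target) :
    ∀ (ν T : ℝ), 0 < ν → 0 < T →
      ∀ (u : ℝ → EuclideanSpace ℝ (Fin 3) → EuclideanSpace ℝ (Fin 3))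
      (p : ℝ → EuclideanSpace ℝ (Fin 3) → ℝ),
      IsMaximalSmoothSolution ν 0 u p T → IsLerayHopfOn T ν 0 (u 0) u → HasRapidSpatialDecay (u 0) →
      IsTypeIBlowup u T → D ν T u p :=
  fun ν T hν hT0 u p hmax hLH hdec hI =>
    absurd (hT ν T hν hT0 u p hmax.1 hLH hdec hI) hmax.2

/-- **Modulo Target every killing candidate IS the hard core.** Under `ThreadingFlux.Target` and KILL,
`(∀ blow-ups, D) ↔ NoTypeII`. [folklore] -/
theorem blowupClause_iff_typeIliouvilleNoTypeII_of_target (hT : Target)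
    (hkill : ∀ (ν T : ℝ), 0 < ν → 0 < T →
      ∀ (u : ℝ → EuclideanSpace ℝ (Fin 3) → EuclideanSpace ℝ (Fin 3))
      (p : ℝ → EuclideanSpace ℝ (Fin 3) → ℝ),
      IsMaximalSmoothSolution ν 0 u p T → IsLerayHopfOn T ν 0 (u 0) u → HasRapidSpatialDecay (u 0) →
      D ν T u p → IsTypeIBlowup u T) :
    (∀ (ν T : ℝ), 0 < ν → 0 < T →
      ∀ (u : ℝ → EuclideanSpace ℝ (Fin 3) → EuclideanSpace ℝ (Fin 3))
      (p : ℝ → EuclideanSpace ℝ (Fin 3) → ℝ),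
      IsMaximalSmoothSolution ν 0 u p T → IsLerayHopfOn T ν 0 (u 0) u → HasRapidSpatialDecay (u 0) →
      D ν T u p) ↔ TypeIliouvilleNoTypeII :=
  blowupClause_iff_typeIliouvilleNoTypeII hkill (typeIResidue_of_target hT)

/-! ### Class-restricted Type-II exclusion («no Type-II blow-up in the class 𝒞») -/

/-- **NoTypeII ⇒ NoTypeII-in-𝒞** for every class `𝒞`. [folklore] -/
theorem noTypeIIIn_of_typeIliouvilleNoTypeII (hII : TypeIliouvilleNoTypeII) :
    ∀ (ν T : ℝ), 0 < ν → 0 < T →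
      ∀ (u : ℝ → EuclideanSpace ℝ (Fin 3) → EuclideanSpace ℝ (Fin 3))
      (p : ℝ → EuclideanSpace ℝ (Fin 3) → ℝ),
      IsMaximalSmoothSolution ν 0 u p T → IsLerayHopfOn T ν 0 (u 0) u → HasRapidSpatialDecay (u 0) →
      𝒞 ν T u p → IsTypeIBlowup u T :=
  fun ν T hν hT u p hmax hLH hdec _ => hII ν T hν hT u p hmax hLH hdec

/-- **Monotonicity in the class**: NoTypeII-in-𝒞' and `𝒞 ⊆ 𝒞'` (on the frame) give NoTypeII-in-𝒞.
[folklore] -/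
theorem noTypeIIIn_mono
    (hsub : ∀ (ν T : ℝ), 0 < ν → 0 < T →
      ∀ (u : ℝ → EuclideanSpace ℝ (Fin 3) → EuclideanSpace ℝ (Fin 3))
      (p : ℝ → EuclideanSpace ℝ (Fin 3) → ℝ),
      IsMaximalSmoothSolution ν 0 u p T → IsLerayHopfOn T ν 0 (u 0) u → HasRapidSpatialDecay (u 0) →
      𝒞 ν T u p → 𝒞' ν T u p)
    (h' : ∀ (ν T : ℝ), 0 < ν → 0 < T →
      ∀ (u : ℝ → EuclideanSpace ℝ (Fin 3) → EuclideanSpace ℝ (Fin 3))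
      (p : ℝ → EuclideanSpace ℝ (Fin 3) → ℝ),
      IsMaximalSmoothSolution ν 0 u p T → IsLerayHopfOn T ν 0 (u 0) u → HasRapidSpatialDecay (u 0) →
      𝒞' ν T u p → IsTypeIBlowup u T) :
    ∀ (ν T : ℝ), 0 < ν → 0 < T →
      ∀ (u : ℝ → EuclideanSpace ℝ (Fin 3) → EuclideanSpace ℝ (Fin 3))
      (p : ℝ → EuclideanSpace ℝ (Fin 3) → ℝ),
      IsMaximalSmoothSolution ν 0 u p T → IsLerayHopfOn T ν 0 (u 0) u → HasRapidSpatialDecay (u 0) →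
      𝒞 ν T u p → IsTypeIBlowup u T :=
  fun ν T hν hT u p hmax hLH hdec h𝒞 =>
    h' ν T hν hT u p hmax hLH hdec (hsub ν T hν hT u p hmax hLH hdec h𝒞)

/-- **Split over a class**: NoTypeII-in-𝒞 and NoTypeII-in-(¬𝒞) give `NoTypeII`. [folklore] -/
theorem typeIliouvilleNoTypeII_of_noTypeIIIn_of_compl
    (h𝒞 : ∀ (ν T : ℝ), 0 < ν → 0 < T →
      ∀ (u : ℝ → EuclideanSpace ℝ (Fin 3) → EuclideanSpace ℝ (Fin 3))
      (p : ℝ → EuclideanSpace ℝ (Fin 3) → ℝ),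
      IsMaximalSmoothSolution ν 0 u p T → IsLerayHopfOn T ν 0 (u 0) u → HasRapidSpatialDecay (u 0) →
      𝒞 ν T u p → IsTypeIBlowup u T)
    (hc𝒞 : ∀ (ν T : ℝ), 0 < ν → 0 < T →
      ∀ (u : ℝ → EuclideanSpace ℝ (Fin 3) → EuclideanSpace ℝ (Fin 3))
      (p : ℝ → EuclideanSpace ℝ (Fin 3) → ℝ),
      IsMaximalSmoothSolution ν 0 u p T → IsLerayHopfOn T ν 0 (u 0) u → HasRapidSpatialDecay (u 0) →
      ¬ 𝒞 ν T u p → IsTypeIBlowup u T) :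
    TypeIliouvilleNoTypeII := by
  intro ν T hν hT u p hmax hLH hdec
  by_cases h : 𝒞 ν T u p
  · exact h𝒞 ν T hν hT u p hmax hLH hdec h
  · exact hc𝒞 ν T hν hT u p hmax hLH hdec h

/-- **A class-restricted candidate closes NoTypeII-in-𝒞**: if the clause `D` holds on every blow-up of
the class `𝒞` and KILL holds on `𝒞`, then no blow-up in `𝒞` is of Type II. [folklore] -/
theorem noTypeIIIn_of_blowupClauseIn_of_killIn
    (hD : ∀ (ν T : ℝ), 0 < ν → 0 < T →
      ∀ (u : ℝ → EuclideanSpace ℝ (Fin 3) → EuclideanSpace ℝ (Fin 3))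
      (p : ℝ → EuclideanSpace ℝ (Fin 3) → ℝ),
      IsMaximalSmoothSolution ν 0 u p T → IsLerayHopfOn T ν 0 (u 0) u → HasRapidSpatialDecay (u 0) →
      𝒞 ν T u p → D ν T u p)
    (hkill : ∀ (ν T : ℝ), 0 < ν → 0 < T →
      ∀ (u : ℝ → EuclideanSpace ℝ (Fin 3) → EuclideanSpace ℝ (Fin 3))
      (p : ℝ → EuclideanSpace ℝ (Fin 3) → ℝ),
      IsMaximalSmoothSolution ν 0 u p T → IsLerayHopfOn T ν 0 (u 0) u → HasRapidSpatialDecay (u 0) →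
      𝒞 ν T u p → D ν T u p → IsTypeIBlowup u T) :
    ∀ (ν T : ℝ), 0 < ν → 0 < T →
      ∀ (u : ℝ → EuclideanSpace ℝ (Fin 3) → EuclideanSpace ℝ (Fin 3))
      (p : ℝ → EuclideanSpace ℝ (Fin 3) → ℝ),
      IsMaximalSmoothSolution ν 0 u p T → IsLerayHopfOn T ν 0 (u 0) u → HasRapidSpatialDecay (u 0) →
      𝒞 ν T u p → IsTypeIBlowup u T :=
  fun ν T hν hT u p hmax hLH hdec h𝒞 =>
    hkill ν T hν hT u p hmax hLH hdec h𝒞 (hD ν T hν hT u p hmax hLH hdec h𝒞)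

/-- **No Type II in 𝒞 ∧ no Type I in 𝒞 ⇒ no blow-up in 𝒞.** If no blow-up of the class `𝒞` is of Type
II, and every classical solution of the class with the Type-I rate continues past `T` (Type-I exclusion in
`𝒞`, the class-restricted `Target`), then every classical Leray–Hopf solution of the class from a rapidly
decaying datum continues past `T`. [folklore] -/
theorem noBlowupIn_of_noTypeIIIn_of_targetIn
    (hII : ∀ (ν T : ℝ), 0 < ν → 0 < T →
      ∀ (u : ℝ → EuclideanSpace ℝ (Fin 3) → EuclideanSpace ℝ (Fin 3))
      (p : ℝ → EuclideanSpace ℝ (Fin 3) → ℝ),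
      IsMaximalSmoothSolution ν 0 u p T → IsLerayHopfOn T ν 0 (u 0) u → HasRapidSpatialDecay (u 0) →
      𝒞 ν T u p → IsTypeIBlowup u T)
    (hI : ∀ (ν T : ℝ), 0 < ν → 0 < T →
      ∀ (u : ℝ → EuclideanSpace ℝ (Fin 3) → EuclideanSpace ℝ (Fin 3))
      (p : ℝ → EuclideanSpace ℝ (Fin 3) → ℝ),
      IsClassicalNSSolutionOn (Set.Ico 0 T) ν 0 u p → IsLerayHopfOn T ν 0 (u 0) u →
      HasRapidSpatialDecay (u 0) → 𝒞 ν T u p → IsTypeIBlowup u T → HasSmoothExtensionPast ν 0 u T) :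
    ∀ (ν T : ℝ), 0 < ν → 0 < T →
      ∀ (u : ℝ → EuclideanSpace ℝ (Fin 3) → EuclideanSpace ℝ (Fin 3))
      (p : ℝ → EuclideanSpace ℝ (Fin 3) → ℝ),
      IsClassicalNSSolutionOn (Set.Ico 0 T) ν 0 u p → IsLerayHopfOn T ν 0 (u 0) u →
      HasRapidSpatialDecay (u 0) → 𝒞 ν T u p → HasSmoothExtensionPast ν 0 u T := by
  intro ν T hν hT u p hcl hLH hdec h𝒞
  by_contra hext
  exact hext (hI ν T hν hT u p hcl hLH hdec h𝒞 (hII ν T hν hT u p ⟨hcl, hext⟩ hLH hdec h𝒞))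

/-! ### The deciding-theorem shape of a §B route (residual = Target, stmt-1217) -/

/-- **Target (1217) ∧ NoTypeII (0056) ⇒ Clay (A)**, with the hard-core declaration
`TypeILiouville.TypeIliouvilleNoTypeII` (pure logic over `TypeILiouville.Assembly_holds`: a non-extendable
solution is maximal, hence Type I by NoTypeII, hence extendable by Target; the `ScaledTopAlignment.NoTypeII`
copy of this composition is `navierStokesRegularity_of_target_of_noTypeII`). [folklore] -/
theorem navierStokesRegularity_of_target_of_typeIliouvilleNoTypeII (hT : Target)
    (hII : TypeIliouvilleNoTypeII) : _root_.NavierStokesRegularity := by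
  apply Summit.NavierStokesRegularity.NavierStokesRegularity.Theses.TypeILiouville.Assembly_holds
  intro ν T hν hT0 u p hcl hLH hdec
  by_contra hext
  exact hext (hT ν T hν hT0 u p hcl hLH hdec (hII ν T hν hT0 u p ⟨hcl, hext⟩ hLH hdec))

/-- **DECIDING-THEOREM SHAPE of a Type-II-exclusion route.** A candidate `∀ blow-ups, D` with KILL proved,
plus the residual `ThreadingFlux.Target` (no Type-I blow-up, stmt-1217), gives Clay (A): the §B mirror of
the door routes' `closes : Door → NoTypeII → NavierStokesRegularity`. [folklore] -/
theorem navierStokesRegularity_of_blowupClause_of_kill_of_target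
    (hD : ∀ (ν T : ℝ), 0 < ν → 0 < T →
      ∀ (u : ℝ → EuclideanSpace ℝ (Fin 3) → EuclideanSpace ℝ (Fin 3))
      (p : ℝ → EuclideanSpace ℝ (Fin 3) → ℝ),
      IsMaximalSmoothSolution ν 0 u p T → IsLerayHopfOn T ν 0 (u 0) u → HasRapidSpatialDecay (u 0) →
      D ν T u p)
    (hkill : ∀ (ν T : ℝ), 0 < ν → 0 < T →
      ∀ (u : ℝ → EuclideanSpace ℝ (Fin 3) → EuclideanSpace ℝ (Fin 3))
      (p : ℝ → EuclideanSpace ℝ (Fin 3) → ℝ),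
      IsMaximalSmoothSolution ν 0 u p T → IsLerayHopfOn T ν 0 (u 0) u → HasRapidSpatialDecay (u 0) →
      D ν T u p → IsTypeIBlowup u T)
    (hT : Target) : _root_.NavierStokesRegularity :=
  navierStokesRegularity_of_target_of_typeIliouvilleNoTypeII hT
    (typeIliouvilleNoTypeII_of_blowupClause_of_kill hD hkill)

/-- **The two route copies of the hard core agree**: `TypeILiouville.TypeIliouvilleNoTypeII` (the
`@[hard_core]` declaration of stmt-0056) and `ThreadingFlux.NoTypeII` are the same statement. [folklore] -/
theorem typeIliouvilleNoTypeII_iff_threadingFluxNoTypeII :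
    TypeIliouvilleNoTypeII ↔
      Summit.NavierStokesRegularity.NavierStokesRegularity.Theses.ThreadingFlux.NoTypeII :=
  Iff.rfl

end Summit.NavierStokesRegularity.NavierStokesRegularity.Theorems

end
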